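import Literature.NumberTheory.Sieve.RosserSieveHalfLemma18
import HarnessLib

/-!
# Rosser's sieve: the discrete recursions for the partial sums and the partial-summation step

Topic `Literature/NumberTheory/Sieve`; Iwaniec, *Rosser's sieve*, Acta Arith. 36 (1980), §4 and §8. This is the
first of the files proving the main-term estimate of Iwaniec's Theorem 1 (the analytic half, Lemma 20 of the
paper in a qualitative form) for the corrected sieve theorem `SieveSequence.Iwaniec1980_lower/upper`
(`SieveFunctions.lean`). It PROVES the discrete, `g`-dependent ingredients of the induction on the number
`R` of boundary terms (all for a multiplicative `g` with `0 ≤ g(p) < 1`, resp. under `Ω(κ, L)`):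

* parity periodicity of Rosser's sets and sums (`pred_congr_of_mod_two_eq`, …, `discT_congr_of_mod_two_eq`);
* the recurrences (4.4)–(4.5) summed over `n`: `discT_zero_succ_succ`
  (`T⁻_{N+2}(y, P(z)) = ∑_{p<z} g(p) T⁺_{N+1}(y/p, P(p))` for the partial sums `BetaSieve.discT`),
  `discT_one_succ_succ` (with the first upper sum `T⁺_1` and the condition `p^{β+1} < y`), and their
  differences between two sifting levels `z₀ ≤ z` (`discT_zero_succ_succ_sub`, `discT_one_succ_succ_sub`:
  only the primes `z₀ ≤ p < z` are peeled off);
* the substitution `x = y^{1/t}` (`dx/(x log x) = −dt/t`) turning the integral of Lemma 21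
  (`RosserSievePartialSummation`) into `∫_s^{s₀} Φ(t) dt/t` (`integral_comp_log_div_log`), the
  normalisation identity `(t − 1)^{−κ} = (log p/log z)^κ s^{−κ} (1 − 1/t)^{−κ}` (`t = log y/log p`,
  `s = log y/log z`), and the resulting ONE-STEP partial-summation bound `sum_peeled_le`:
  `∑_{z₀ ≤ p < z} g(p) V(P(p)) (log p/log z)^κ Φ(log y/log p) ≤ V(P(z)) {κ ∫_s^{s₀} Φ(t) dt/t + Φ(s)(κ+1)L/log z₀}`
  for `Φ ≥ 0` non-increasing and continuous (Iwaniec's (8.5)–(8.6));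
* Rankin's trick at the truncation level `z₀ = e^{√(log y)}` (`discT_exp_sqrt_le`: the crude bound of
  (8.4), here `∑_{n ≤ N} T_n(y, P(z₀)) ≤ C V(P(z₀)) s₀^{−κ} e^{−s₀} (log y)^{−e}`, `s₀ = √(log y)`) and for
  the tail of the boundary series (`discT_le_discT_add_tail`).

The analytic ingredients (majorants) are in `RosserSieveMajorantPackage.lean`; the induction itself in
`RosserSieveInduction.lean`.

## References

* H. Iwaniec, *Rosser's sieve*, Acta Arith. 36 (1980), 171–202: §4 (4.3)–(4.6), §8 (8.2)–(8.6), (8.4).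
  [IwaniecActaArith1980]
* G. Greaves, *Sieves in Number Theory*, Springer (2001), §4.1.1 (Lemma 1), §4.1.2 (Lemma 2), §4.4.3.
  [Greaves2001]
-/

open Finset Filter Set MeasureTheory intervalIntegral
open scoped ArithmeticFunction.Moebius ArithmeticFunction.omega Topology

noncomputable section

namespace Literature.NumberTheory.Sieve

namespace BetaSieve

open BetaSieveForward (sieveKernel sieveKernel_nonneg continuousOn_sieveKernel)

variable {g : ArithmeticFunction ℝ} {κ β : ℝ}

/-! ### Parity periodicity of Rosser's truncation sets -/

/-- The truncation sets depend on the parity parameter only through its residue mod `2`.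
[folklore] -/
theorem pred_congr_of_mod_two_eq {par par' : ℕ} (h : par % 2 = par' % 2) (β D : ℝ) :
    ∀ d : ℕ, pred par β D d ↔ pred par' β D d := by
  intro d
  induction d using Nat.strong_induction_on generalizing D with
  | _ d ih =>
    by_cases hd : d ≤ 1
    · exact ⟨fun _ => pred_of_le_one hd, fun _ => pred_of_le_one hd⟩
    · have hd1 : 1 < d := not_le.mp hd
      have hlt : d / d.minFac < d := Nat.div_lt_self (by omega) (Nat.minFac_prime (by omega)).one_lt
      rw [pred_iff hd1, pred_iff hd1, ih _ hlt D, h]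

/-- `χ̄^{par}` depends on `par` only mod `2`. [folklore] -/
theorem bdry_congr_of_mod_two_eq {par par' : ℕ} (h : par % 2 = par' % 2) (β D : ℝ) (t : ℕ) :
    bdry par β D t = bdry par' β D t := by
  unfold bdry
  rw [pred_congr_of_mod_two_eq h β D, pred_congr_of_mod_two_eq h β D]

/-- `T^{par}_n` depends on `par` only mod `2`. [folklore] -/
theorem bdrySum_congr_of_mod_two_eq {par par' : ℕ} (h : par % 2 = par' % 2) (g : ArithmeticFunction ℝ)
    (β D : ℝ) (P n : ℕ) : bdrySum par g β D P n = bdrySum par' g β D P n := by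
  unfold bdrySum
  exact Finset.sum_congr rfl fun t _ => by rw [bdry_congr_of_mod_two_eq h]

/-- The partial sums `T^{par}_N(D, P)` depend on `par` only mod `2`. [folklore] -/
theorem discT_congr_of_mod_two_eq {par par' : ℕ} (h : par % 2 = par' % 2) (g : ArithmeticFunction ℝ)
    (β D : ℝ) (P N : ℕ) : discT par g β D P N = discT par' g β D P N := by
  unfold discT
  exact Finset.sum_congr rfl fun n _ => bdrySum_congr_of_mod_two_eq h g β D P n

/-! ### The recurrences for the partial sums `T^±_{R,z}` (Iwaniec (4.4)–(4.5) summed over `n`) -/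

/-- `T⁻_{m+1}(y, P(z)) = ∑_{p < z} g(p) T⁺_m(y/p, P(p))` for every `m` (for `m = 0` both sides
vanish). [cite: IwaniecActaArith1980, (4.4)] -/
theorem bdrySum_zero_succ_eq_sum (hg : g.IsMultiplicative) (β y z : ℝ) (m : ℕ) :
    bdrySum 0 g β y (primesProdBelow z) (m + 1) =
      ∑ p ∈ Nat.primesBelow ⌈z⌉₊, g p * bdrySum 1 g β (y / p) (primesProdBelow p) m := by
  cases m with
  | zero =>
    rw [bdrySum_zero_one_eq]
    refine (Finset.sum_eq_zero fun p _ => ?_).symm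
    rw [bdrySum_zero 1 g β _ (primesProdBelow_ne_zero _), mul_zero]
  | succ k =>
    rw [bdrySum_succ_succ hg 0 β y z k]
    refine Finset.sum_congr rfl fun p _ => ?_
    rw [if_pos (fun h => by norm_num at h),
      bdrySum_congr_of_mod_two_eq (by norm_num : (0 + 1) % 2 = 1 % 2)]

/-- `T⁺_{k+2}(y, P(z)) = ∑_{p < z, p^{β+1} < y} g(p) T⁻_{k+1}(y/p, P(p))`. [cite: IwaniecActaArith1980, (4.5)] -/
theorem bdrySum_one_succ_succ_eq_sum (hg : g.IsMultiplicative) (β y z : ℝ) (k : ℕ) :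
    bdrySum 1 g β y (primesProdBelow z) (k + 2) =
      ∑ p ∈ Nat.primesBelow ⌈z⌉₊, (if (p : ℝ) ^ (β + 1) < y then g p else 0) *
        bdrySum 0 g β (y / p) (primesProdBelow p) (k + 1) := by
  rw [bdrySum_succ_succ hg 1 β y z k]
  refine Finset.sum_congr rfl fun p _ => ?_
  rw [bdrySum_congr_of_mod_two_eq (by norm_num : (1 + 1) % 2 = 0 % 2)]
  by_cases h : (p : ℝ) ^ (β + 1) < y
  · rw [if_pos (fun _ => h), if_pos h]
  · rw [if_neg (fun h' => h (h' (by norm_num))), if_neg h]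

/-- **The lower partial sums through the upper ones** ((4.4) summed):
`T⁻_{N+2}(y, P(z)) = ∑_{p < z} g(p) T⁺_{N+1}(y/p, P(p))` (partial sums `discT`).
[cite: IwaniecActaArith1980, (4.4)] -/
theorem discT_zero_succ_succ (hg : g.IsMultiplicative) (β y z : ℝ) (N : ℕ) :
    discT 0 g β y (primesProdBelow z) (N + 2) =
      ∑ p ∈ Nat.primesBelow ⌈z⌉₊, g p * discT 1 g β (y / p) (primesProdBelow p) (N + 1) := by
  rw [discT, Finset.sum_range_succ', bdrySum_zero 0 g β y (primesProdBelow_ne_zero z), add_zero]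
  simp_rw [bdrySum_zero_succ_eq_sum hg β y z, discT, Finset.mul_sum]
  exact Finset.sum_comm

/-- **The upper partial sums through the lower ones** ((4.3), (4.5) summed):
`T⁺_{N+2}(y, P(z)) = T⁺_1(y, P(z)) + ∑_{p < z, p^{β+1} < y} g(p) T⁻_{N+1}(y/p, P(p))`.
[cite: IwaniecActaArith1980, (4.5)] -/
theorem discT_one_succ_succ (hg : g.IsMultiplicative) (β y z : ℝ) (N : ℕ) :
    discT 1 g β y (primesProdBelow z) (N + 2) =
      bdrySum 1 g β y (primesProdBelow z) 1 +
        ∑ p ∈ Nat.primesBelow ⌈z⌉₊, (if (p : ℝ) ^ (β + 1) < y then g p else 0) *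
          discT 0 g β (y / p) (primesProdBelow p) (N + 1) := by
  have h1 : discT 1 g β y (primesProdBelow z) (N + 2) =
      bdrySum 1 g β y (primesProdBelow z) 1 +
        ∑ k ∈ Finset.range (N + 1), bdrySum 1 g β y (primesProdBelow z) (k + 2) := by
    rw [discT, Finset.sum_range_succ', Finset.sum_range_succ',
      bdrySum_zero 1 g β y (primesProdBelow_ne_zero z), add_zero, add_comm]
  have h2 : ∀ p : ℕ, discT 0 g β (y / p) (primesProdBelow p) (N + 1) =
      ∑ k ∈ Finset.range (N + 1), bdrySum 0 g β (y / p) (primesProdBelow p) (k + 1) := by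
    intro p
    rw [discT, Finset.sum_range_succ', bdrySum_zero 0 g β _ (primesProdBelow_ne_zero _), add_zero]
  rw [h1]
  simp_rw [bdrySum_one_succ_succ_eq_sum hg β y z, h2, Finset.mul_sum]
  rw [Finset.sum_comm]

/-- The primes below `⌈z⌉` that are not below `⌈z₀⌉` are those `p` with `z₀ ≤ p`. [folklore] -/
theorem sum_primesBelow_sub_sum_primesBelow {z₀ z : ℝ} (hz : z₀ ≤ z) (Ψ : ℕ → ℝ) :
    ∑ p ∈ Nat.primesBelow ⌈z⌉₊, Ψ p - ∑ p ∈ Nat.primesBelow ⌈z₀⌉₊, Ψ p =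
      ∑ p ∈ (Nat.primesBelow ⌈z⌉₊).filter (fun p : ℕ => z₀ ≤ (p : ℝ)), Ψ p := by
  have hsub : Nat.primesBelow ⌈z₀⌉₊ ⊆ Nat.primesBelow ⌈z⌉₊ := Nat.primesBelow_mono (Nat.ceil_mono hz)
  rw [← Finset.sum_sdiff hsub, add_sub_cancel_right]
  refine Finset.sum_congr ?_ fun _ _ => rfl
  ext p
  simp only [Finset.mem_sdiff, Finset.mem_filter, Nat.mem_primesBelow, Nat.lt_ceil, not_and]
  constructor
  · rintro ⟨⟨hpz, hp⟩, h⟩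
    refine ⟨⟨hpz, hp⟩, ?_⟩
    by_contra hlt
    exact absurd hp (h (not_le.mp hlt))
  · rintro ⟨⟨hpz, hp⟩, h⟩
    exact ⟨⟨hpz, hp⟩, fun hlt => absurd hlt (not_lt.mpr h)⟩

/-- **Peeling the primes of `[z₀, z)`, lower parity**: for `z₀ ≤ z`,
`T⁻_{N+2}(y, P(z)) − T⁻_{N+2}(y, P(z₀)) = ∑_{z₀ ≤ p < z} g(p) T⁺_{N+1}(y/p, P(p))`.
[cite: IwaniecActaArith1980, (4.4)] -/
theorem discT_zero_succ_succ_sub (hg : g.IsMultiplicative) (β y : ℝ) {z₀ z : ℝ} (hz : z₀ ≤ z) (N : ℕ) :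
    discT 0 g β y (primesProdBelow z) (N + 2) - discT 0 g β y (primesProdBelow z₀) (N + 2) =
      ∑ p ∈ (Nat.primesBelow ⌈z⌉₊).filter (fun p : ℕ => z₀ ≤ (p : ℝ)),
        g p * discT 1 g β (y / p) (primesProdBelow p) (N + 1) := by
  rw [discT_zero_succ_succ hg, discT_zero_succ_succ hg, sum_primesBelow_sub_sum_primesBelow hz]

/-- **Peeling the primes of `[z₀, z)`, upper parity**: for `z₀ ≤ z`,
`T⁺_{N+2}(y, P(z)) − T⁺_{N+2}(y, P(z₀)) = T⁺_1(y, P(z)) − T⁺_1(y, P(z₀)) + ∑_{z₀ ≤ p < z, p^{β+1} < y} g(p) T⁻_{N+1}(y/p, P(p))`.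
[cite: IwaniecActaArith1980, (4.5)] -/
theorem discT_one_succ_succ_sub (hg : g.IsMultiplicative) (β y : ℝ) {z₀ z : ℝ} (hz : z₀ ≤ z) (N : ℕ) :
    discT 1 g β y (primesProdBelow z) (N + 2) - discT 1 g β y (primesProdBelow z₀) (N + 2) =
      bdrySum 1 g β y (primesProdBelow z) 1 - bdrySum 1 g β y (primesProdBelow z₀) 1 +
      ∑ p ∈ (Nat.primesBelow ⌈z⌉₊).filter (fun p : ℕ => z₀ ≤ (p : ℝ)),
        (if (p : ℝ) ^ (β + 1) < y then g p else 0) * discT 0 g β (y / p) (primesProdBelow p) (N + 1) := by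
  rw [discT_one_succ_succ hg, discT_one_succ_succ hg, ← sum_primesBelow_sub_sum_primesBelow hz]
  ring

/-! ### The substitution `x = y^{1/t}` in Lemma 21 -/

/-- For `y > 1` and `x > 1`, `x = y^{1/t}` with `t = log y / log x > 0`. [folklore] -/
theorem rpow_one_div_log_div_log {y x : ℝ} (hy : 1 < y) (hx : 1 < x) :
    y ^ (1 / (Real.log y / Real.log x)) = x := by
  have hlogy : 0 < Real.log y := Real.log_pos hy
  have hlogx : 0 < Real.log x := Real.log_pos hx
  rw [one_div, inv_div, Real.rpow_def_of_pos (by linarith), mul_div_cancel₀ _ hlogy.ne',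
    Real.exp_log (by linarith)]

/-- For `y > 1`, `log y / log (y^{1/t}) = t` (`log (y^{1/t}) = log y / t`). [folklore] -/
theorem log_div_log_rpow {y : ℝ} (hy : 1 < y) (t : ℝ) :
    Real.log y / Real.log (y ^ (1 / t)) = t := by
  have hlogy : 0 < Real.log y := Real.log_pos hy
  rw [Real.log_rpow (by linarith), one_div, inv_mul_eq_div, div_div_eq_mul_div, mul_div_assoc,
    mul_div_cancel₀ _ hlogy.ne']

/-- **The substitution `x = y^{1/t}`** (`dx/(x log x) = −dt/t`): for `y > 1`, `0 < s ≤ s₀` and `Φ`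
continuous on `[s, s₀]`,
`∫_{y^{1/s₀}}^{y^{1/s}} Φ(log y/log x) dx/(x log x) = ∫_s^{s₀} Φ(t) dt/t`. [folklore] -/
theorem integral_comp_log_div_log {y s s₀ : ℝ} (hy : 1 < y) (hs : 0 < s) (hss₀ : s ≤ s₀)
    {Φ : ℝ → ℝ} (hΦc : ContinuousOn Φ (Icc s s₀)) :
    ∫ x in (y ^ (1 / s₀))..(y ^ (1 / s)), Φ (Real.log y / Real.log x) / (x * Real.log x) =
      ∫ t in s..s₀, Φ t / t := by
  have hlogy : 0 < Real.log y := Real.log_pos hy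
  have hs₀ : 0 < s₀ := lt_of_lt_of_le hs hss₀
  set a := y ^ (1 / s₀) with ha
  set b := y ^ (1 / s) with hb
  have ha1 : 1 < a := Real.one_lt_rpow hy (by positivity)
  have hb1 : 1 < b := Real.one_lt_rpow hy (by positivity)
  have hab : a ≤ b := Real.rpow_le_rpow_of_exponent_le hy.le
    (by rw [one_div_le_one_div hs₀ hs]; exact hss₀)
  set f : ℝ → ℝ := fun x => Real.log y / Real.log x with hf
  set f' : ℝ → ℝ := fun x => -(Real.log y / (x * Real.log x ^ 2)) with hf'
  have hfa : f a = s₀ := log_div_log_rpow hy s₀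
  have hfb : f b = s := log_div_log_rpow hy s
  -- derivative of `f` on `(1, ∞)`
  have hderiv : ∀ x, 1 < x → HasDerivAt f (f' x) x := by
    intro x hx
    have hx0 : x ≠ 0 := by positivity
    have hlogx : Real.log x ≠ 0 := (Real.log_pos hx).ne'
    have h := ((Real.hasDerivAt_log hx0).inv hlogx).const_mul (Real.log y)
    refine h.congr_deriv ?_
    rw [hf']; field_simp
  have hfc : ContinuousOn f (Icc a b) := fun x hx =>
    (hderiv x (by linarith [hx.1])).continuousAt.continuousWithinAt
  have hf'c : ContinuousOn f' (Icc a b) := by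
    refine ContinuousOn.neg (continuousOn_const.div (continuousOn_id.mul
      ((Real.continuousOn_log.mono fun x hx => ?_).pow 2)) fun x hx => ?_)
    · exact ne_of_gt (by linarith [hx.1] : (0:ℝ) < x)
    · have : 0 < Real.log x := Real.log_pos (by linarith [hx.1])
      have : (0:ℝ) < x := by linarith [hx.1]
      positivity
  -- the image of `[a, b]` lies in `[s, s₀]`
  have hmaps : ∀ x ∈ Icc a b, f x ∈ Icc s s₀ := by
    intro x hx
    have hx1 : 1 < x := by linarith [hx.1]
    have hlogx : 0 < Real.log x := Real.log_pos hx1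
    have hloga : Real.log a ≤ Real.log x := Real.log_le_log (by linarith) hx.1
    have hlogb : Real.log x ≤ Real.log b := Real.log_le_log (by linarith) hx.2
    rw [ha, Real.log_rpow (by linarith), one_div] at hloga
    rw [hb, Real.log_rpow (by linarith), one_div] at hlogb
    constructor
    · -- `s ≤ log y / log x` iff `log x ≤ log y / s`
      rw [hf, le_div_iff₀ hlogx]
      calc s * Real.log x ≤ s * (s⁻¹ * Real.log y) := mul_le_mul_of_nonneg_left hlogb hs.le
        _ = Real.log y := by field_simp
    · rw [hf, div_le_iff₀ hlogx]
      calc Real.log y = s₀ * (s₀⁻¹ * Real.log y) := by field_simp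
        _ ≤ s₀ * Real.log x := mul_le_mul_of_nonneg_left hloga hs₀.le
  have hgc : ContinuousOn (fun t => -(Φ t / t)) (f '' uIcc a b) := by
    rw [uIcc_of_le hab]
    refine (ContinuousOn.neg (hΦc.div continuousOn_id fun t ht => ne_of_gt (lt_of_lt_of_le hs ht.1))).mono ?_
    rintro _ ⟨x, hx, rfl⟩
    exact hmaps x hx
  have hmain := intervalIntegral.integral_comp_mul_deriv'' (a := a) (b := b) (f := f) (f' := f')
    (g := fun t => -(Φ t / t)) (by rwa [uIcc_of_le hab])
    (fun x hx => by
      rw [min_eq_left hab, max_eq_right hab] at hx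
      exact (hderiv x (by linarith [hx.1])).hasDerivWithinAt)
    (by rwa [uIcc_of_le hab]) hgc
  rw [hfa, hfb, intervalIntegral.integral_symm s s₀, intervalIntegral.integral_neg, neg_neg] at hmain
  rw [← hmain]
  refine intervalIntegral.integral_congr fun x hx => ?_
  rw [uIcc_of_le hab] at hx
  have hx1 : 1 < x := by linarith [hx.1]
  have hlogx : 0 < Real.log x := Real.log_pos hx1
  have hfx : 0 < f x := div_pos hlogy hlogx
  simp only [Function.comp_apply, hf', hf]
  field_simp

/-! ### One step of the induction: partial summation over the peeled primes -/

/-- **The normalisation identity**: with `s = log y/log z`, `t = log y/log p` (`1 < p < y`, `1 < z`),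
`(t − 1)^{−κ} = (log p/log z)^κ s^{−κ} (1 − 1/t)^{−κ}`. [folklore] -/
theorem rpow_neg_log_div_log_sub_one {y z : ℝ} {p : ℝ} (hy : 1 < y) (hz : 1 < z) (hp1 : 1 < p) (hpy : p < y)
    (κ : ℝ) :
    (Real.log y / Real.log p - 1) ^ (-κ) =
      (Real.log p / Real.log z) ^ κ * (Real.log y / Real.log z) ^ (-κ) *
        (1 - 1 / (Real.log y / Real.log p)) ^ (-κ) := by
  have hlogy : 0 < Real.log y := Real.log_pos hy
  have hlogz : 0 < Real.log z := Real.log_pos hz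
  have hlogp : 0 < Real.log p := Real.log_pos hp1
  have hlt : Real.log p < Real.log y := Real.log_lt_log (by linarith) hpy
  have e1 : Real.log y / Real.log p - 1 = (Real.log y - Real.log p) / Real.log p := by field_simp
  have e2 : 1 - 1 / (Real.log y / Real.log p) = (Real.log y - Real.log p) / Real.log y := by field_simp
  rw [e1, e2, Real.div_rpow (by linarith) hlogp.le, Real.div_rpow hlogp.le hlogz.le,
    Real.div_rpow hlogy.le hlogz.le, Real.div_rpow (by linarith) hlogy.le,
    Real.rpow_neg (by linarith : 0 ≤ Real.log y - Real.log p), Real.rpow_neg hlogp.le,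
    Real.rpow_neg hlogy.le, Real.rpow_neg hlogz.le]
  have h1 : (Real.log p) ^ κ ≠ 0 := (Real.rpow_pos_of_pos hlogp κ).ne'
  have h2 : (Real.log z) ^ κ ≠ 0 := (Real.rpow_pos_of_pos hlogz κ).ne'
  have h3 : (Real.log y) ^ κ ≠ 0 := (Real.rpow_pos_of_pos hlogy κ).ne'
  have h4 : (Real.log y - Real.log p) ^ κ ≠ 0 := (Real.rpow_pos_of_pos (by linarith) κ).ne'
  field_simp

/-- **Partial summation over the peeled primes** (Iwaniec, §8: Lemma 21 applied to the inductive bound,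
then the substitution `x = y^{1/t}`): for `y > 1`, `2 ≤ z₀ ≤ z`, `s = log y/log z`, `s₀ = log y/log z₀`
and `Φ ≥ 0` continuous and non-increasing on `[s, s₀]`,
`∑_{z₀ ≤ p < z} g(p) V(P(p)) (log p/log z)^κ Φ(log y/log p) ≤ V(P(z)) {κ ∫_s^{s₀} Φ(t) dt/t + Φ(s)(κ + 1) L/log z₀}`.
[cite: IwaniecActaArith1980, §8 (8.2) and (8.5)–(8.6)] -/
theorem sum_peeled_le {L : ℝ} (hdim : HasIwaniecDimension g κ L) (hκ : 0 ≤ κ) {y z₀ z : ℝ} (hy : 1 < y)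
    (hz₀ : 2 ≤ z₀) (hz₀z : z₀ ≤ z) {Φ : ℝ → ℝ}
    (hΦ0 : ∀ t ∈ Icc (Real.log y / Real.log z) (Real.log y / Real.log z₀), 0 ≤ Φ t)
    (hΦm : AntitoneOn Φ (Icc (Real.log y / Real.log z) (Real.log y / Real.log z₀)))
    (hΦc : ContinuousOn Φ (Icc (Real.log y / Real.log z) (Real.log y / Real.log z₀))) :
    ∑ p ∈ (Nat.primesBelow ⌈z⌉₊).filter (fun p : ℕ => z₀ ≤ (p : ℝ)),
        g p * vprod g (primesProdBelow p) * ((Real.log p / Real.log z) ^ κ * Φ (Real.log y / Real.log p)) ≤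
      vprod g (primesProdBelow z) *
        (κ * (∫ t in (Real.log y / Real.log z)..(Real.log y / Real.log z₀), Φ t / t) +
          Φ (Real.log y / Real.log z) * ((κ + 1) * L / Real.log z₀)) := by
  set s := Real.log y / Real.log z with hs
  set s₀ := Real.log y / Real.log z₀ with hs₀
  have hlogy : 0 < Real.log y := Real.log_pos hy
  have hz1 : 1 < z := by linarith
  have hz₀1 : 1 < z₀ := by linarith
  have hlogz : 0 < Real.log z := Real.log_pos hz1
  have hlogz₀ : 0 < Real.log z₀ := Real.log_pos hz₀1
  have hspos : 0 < s := div_pos hlogy hlogz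
  have hss₀ : s ≤ s₀ := div_le_div_of_nonneg_left hlogy.le hlogz₀ (Real.log_le_log (by linarith) hz₀z)
  -- `B(x) = Φ(log y / log x)` on `[z₀, z]`
  have hmaps : ∀ x ∈ Icc z₀ z, Real.log y / Real.log x ∈ Icc s s₀ := by
    intro x hx
    have hlogx : 0 < Real.log x := Real.log_pos (by linarith [hx.1])
    exact ⟨div_le_div_of_nonneg_left hlogy.le hlogx (Real.log_le_log (by linarith [hx.1]) hx.2),
      div_le_div_of_nonneg_left hlogy.le hlogz₀ (Real.log_le_log (by linarith) hx.1)⟩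
  have hB0 : ∀ x ∈ Icc z₀ z, 0 ≤ Φ (Real.log y / Real.log x) := fun x hx => hΦ0 _ (hmaps x hx)
  have hBm : MonotoneOn (fun x => Φ (Real.log y / Real.log x)) (Icc z₀ z) := by
    intro x hx x' hx' hxx'
    have hlogx : 0 < Real.log x := Real.log_pos (by linarith [hx.1])
    exact hΦm (hmaps x' hx') (hmaps x hx)
      (div_le_div_of_nonneg_left hlogy.le hlogx (Real.log_le_log (by linarith [hx.1]) hxx'))
  have hBc : ContinuousOn (fun x => Φ (Real.log y / Real.log x)) (Icc z₀ z) := by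
    refine hΦc.comp (continuousOn_const.div (Real.continuousOn_log.mono fun x hx => ?_) fun x hx => ?_) hmaps
    · exact ne_of_gt (by linarith [hx.1] : (0:ℝ) < x)
    · exact (Real.log_pos (by linarith [hx.1])).ne'
  have h21 := sum_primes_rpow_mul_le' hdim hκ hz₀ hz₀z hB0 hBm hBc
  have hzz : y ^ (1 / s) = z := rpow_one_div_log_div_log hy hz1
  have hzz₀ : y ^ (1 / s₀) = z₀ := rpow_one_div_log_div_log hy hz₀1
  have hI := integral_comp_log_div_log hy hspos hss₀ hΦc
  rw [hzz, hzz₀] at hI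
  rw [hI] at h21
  exact h21

/-! ### The truncation level `z₀ = exp(√(log y))` and the crude bound there (Rankin's trick) -/

section Crude

variable {L : ℝ}

/-- `log (exp √(log y)) = √(log y)` and `log y / log (exp √(log y)) = √(log y)` for `y > 1`. [folklore] -/
theorem log_div_log_exp_sqrt {y : ℝ} (hy : 1 < y) :
    Real.log y / Real.log (Real.exp (Real.sqrt (Real.log y))) = Real.sqrt (Real.log y) := by
  have hlogy : 0 < Real.log y := Real.log_pos hy
  have hsq : 0 < Real.sqrt (Real.log y) := Real.sqrt_pos.mpr hlogy
  rw [Real.log_exp, div_eq_iff hsq.ne', Real.mul_self_sqrt hlogy.le]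

/-- **The crude bound at the truncation level** (Iwaniec (8.4), qualitative form at `z₀ = e^{√(log y)}`,
`s₀ = log y / log z₀ = √(log y)`): for `β ≥ 1`, `L ≥ 0`, `e ≤ 1` there are `C` and `y₀` such
that for every multiplicative `g` with `Ω(κ, L)`, all `y ≥ y₀`, both parities and all `N`,
`∑_{n ≤ N} T_n(y, P(z₀)) ≤ C V(P(z₀)) s₀^{−κ} e^{−s₀} (log y)^{−e}`. (Rankin's trick with `Λ = 9`: the terms
with `n + β ≤ s₀` vanish, the others total `≤ (9/8) 9^{β − s₀} V^{−9}`, and `V^{−1} ≤ K₁ s₀^κ`; then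
`9^{−s₀} s₀^{M} ≤ M! e^{−s₀}`-type bounds.) [cite: IwaniecActaArith1980, §8 (8.4)] -/
theorem discT_exp_sqrt_le {κ β : ℝ} (hβ : 1 ≤ β) (hL : 0 ≤ L) {e : ℝ} (he1 : e ≤ 1) :
    ∃ C y₀ : ℝ, 0 ≤ C ∧ 1 < y₀ ∧ ∀ g : ArithmeticFunction ℝ, g.IsMultiplicative → HasIwaniecDimension g κ L →
      ∀ y : ℝ, y₀ ≤ y → ∀ (par N : ℕ),
        discT par g β y (primesProdBelow (Real.exp (Real.sqrt (Real.log y)))) N ≤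
          C * vprod g (primesProdBelow (Real.exp (Real.sqrt (Real.log y)))) *
            Real.sqrt (Real.log y) ^ (-κ) * Real.exp (-Real.sqrt (Real.log y)) * Real.log y ^ (-e) := by
  -- constants
  set m' : ℕ := ⌈κ⌉₊ with hm'
  set K₁ : ℝ := (1 + L / Real.log 2) / Real.log 2 ^ κ with hK₁
  set M : ℕ := 11 * m' + 2 with hM
  have hlog2 : 0 < Real.log 2 := Real.log_pos one_lt_two
  have hK₁0 : 0 < K₁ := div_pos (by positivity) (Real.rpow_pos_of_pos hlog2 κ)
  -- `y₀ = exp 4`: then `√(log y) ≥ 2`, `z₀ ≥ e² ≥ 2`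
  refine ⟨9 / 8 * (9 : ℝ) ^ β * K₁ ^ 10 * M.factorial, Real.exp 4, by positivity,
    by linarith [Real.add_one_le_exp (4:ℝ)], ?_⟩
  intro g hg hdim y hy par N
  have hy1 : 1 < y := by linarith [Real.add_one_le_exp (4:ℝ)]
  have hlogy4 : 4 ≤ Real.log y := by
    rw [Real.le_log_iff_exp_le (by linarith)]; exact hy
  have hlogy : 0 < Real.log y := by linarith
  set s := Real.sqrt (Real.log y) with hs
  have hs2 : 2 ≤ s := by
    rw [hs, show (2:ℝ) = Real.sqrt 4 by rw [show (4:ℝ) = 2 ^ 2 by norm_num, Real.sqrt_sq (by norm_num)]]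
    exact Real.sqrt_le_sqrt hlogy4
  have hs0 : 0 < s := by linarith
  have hs1 : 1 ≤ s := by linarith
  have hss : s * s = Real.log y := by rw [hs, Real.mul_self_sqrt hlogy.le]
  set z := Real.exp s with hz
  have hlogz : Real.log z = s := by rw [hz, Real.log_exp]
  have hz2 : 2 ≤ z := by
    have : (2:ℝ) ≤ Real.exp 2 := by linarith [Real.add_one_le_exp (2:ℝ)]
    exact this.trans (Real.exp_le_exp.mpr hs2)
  have hz1 : 1 < z := by linarith
  have hy0 : 0 < y := by linarith
  have hβ0 : 0 < β := by linarith
  set V := vprod g (primesProdBelow z) with hV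
  have hVpos : 0 < V := hdim.vprod_pos z
  have h01 : ∀ p ∈ (primesProdBelow z).primeFactors, 0 ≤ g p ∧ g p < 1 := fun p hp =>
    hdim.1 p (Nat.prime_of_mem_primeFactors hp)
  have h01' : ∀ p ∈ (primesProdBelow z).primeFactors, 0 ≤ g p ∧ g p ≤ 1 := fun p hp =>
    ⟨(h01 p hp).1, (h01 p hp).2.le⟩
  have hPsq := squarefree_primesProdBelow z
  -- (a) `V⁻¹ ≤ K₁ s^{m'}`
  have hVinv : V⁻¹ ≤ K₁ * s ^ m' := by
    have h1 := hdim.inv_vprod_le hz2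
    rw [hlogz] at h1
    have h3 : (s / Real.log 2) ^ κ = s ^ κ / Real.log 2 ^ κ := Real.div_rpow hs0.le hlog2.le κ
    have h4 : s ^ κ ≤ s ^ m' := by
      rw [← Real.rpow_natCast s m']
      exact Real.rpow_le_rpow_of_exponent_le hs1 (Nat.le_ceil _)
    calc V⁻¹ ≤ (s / Real.log 2) ^ κ * (1 + L / Real.log 2) := h1
      _ ≤ (s ^ m' / Real.log 2 ^ κ) * (1 + L / Real.log 2) := by
          gcongr
          exact h3.le.trans (div_le_div_of_nonneg_right h4 (Real.rpow_pos_of_pos hlog2 κ).le)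
      _ = K₁ * s ^ m' := by rw [hK₁]; ring
  -- (b) Rankin with `Λ = 9`
  set n₀ : ℕ := ⌊s - β⌋₊ + 1 with hn₀
  have hsdef : Real.log y / Real.log z = s := by rw [hlogz, ← hss, mul_div_assoc, div_self hs0.ne', mul_one]
  have hterm : ∀ n ∈ Finset.range (N + 1), bdrySum par g β y (primesProdBelow z) n ≤
      if n₀ ≤ n then V ^ (-(9 : ℝ)) * (1 / 9 : ℝ) ^ n else 0 := by
    intro n _
    split_ifs with hn
    · calc bdrySum par g β y (primesProdBelow z) n
          ≤ ∑ t ∈ (primesProdBelow z).divisors with t.primeFactors.card = n, g t :=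
            bdrySum_le_sum hg hPsq h01' par β y n
        _ ≤ (∏ p ∈ (primesProdBelow z).primeFactors, (1 + 9 * g p)) / 9 ^ n :=
            sum_divisors_card_eq_le hg hPsq (fun p hp => (h01 p hp).1) (by norm_num) n
        _ ≤ V ^ (-(9 : ℝ)) / 9 ^ n :=
            div_le_div_of_nonneg_right (prod_one_add_mul_le h01 (by norm_num)) (by positivity)
        _ = V ^ (-(9 : ℝ)) * (1 / 9 : ℝ) ^ n := by rw [one_div, inv_pow, div_eq_mul_inv]
    · push Not at hn
      rcases Nat.eq_zero_or_pos n with hn0 | hnpos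
      · subst hn0; exact (bdrySum_zero par g β y (primesProdBelow_ne_zero z)).le
      · refine (bdrySum_eq_zero_of_card_add_le hβ0 hz1 hy0 ?_).le
        rw [hsdef]
        have hnle : n ≤ ⌊s - β⌋₊ := Nat.le_of_lt_succ hn
        have hpos : 0 < ⌊s - β⌋₊ := lt_of_lt_of_le hnpos hnle
        have hsb : 0 ≤ s - β := by
          have := Nat.floor_pos.mp hpos
          linarith
        have : (n : ℝ) ≤ ⌊s - β⌋₊ := by exact_mod_cast hnle
        linarith [Nat.floor_le hsb]
  have hsum : discT par g β y (primesProdBelow z) N ≤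
      V ^ (-(9 : ℝ)) * ((1 / 9 : ℝ) ^ n₀ / (1 - 1 / 9)) := by
    calc discT par g β y (primesProdBelow z) N
        ≤ ∑ n ∈ Finset.range (N + 1), (if n₀ ≤ n then V ^ (-(9 : ℝ)) * (1 / 9 : ℝ) ^ n else 0) :=
          Finset.sum_le_sum hterm
      _ = V ^ (-(9 : ℝ)) * ∑ n ∈ Finset.Ico n₀ (N + 1), (1 / 9 : ℝ) ^ n := by
          rw [← Finset.sum_filter, Finset.mul_sum]
          refine Finset.sum_congr ?_ fun _ _ => rfl
          ext n
          simp only [Finset.mem_filter, Finset.mem_range, Finset.mem_Ico, and_comm]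
      _ ≤ V ^ (-(9 : ℝ)) * ((1 / 9 : ℝ) ^ n₀ / (1 - 1 / 9)) :=
          mul_le_mul_of_nonneg_left (geom_sum_Ico_le_of_lt_one (by norm_num) (by norm_num))
            (Real.rpow_nonneg hVpos.le _)
  -- (c) `(1/9)^{n₀} ≤ 9^β e^{-2s}`
  have hgeo : (1 / 9 : ℝ) ^ n₀ ≤ (9 : ℝ) ^ β * Real.exp (-(2 * s)) := by
    have hn₀s : s - β < n₀ := by rw [hn₀]; push_cast; exact Nat.lt_floor_add_one (s - β)
    have e1 : (1 / 9 : ℝ) ^ n₀ = (9 : ℝ) ^ (-(n₀ : ℝ)) := by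
      rw [Real.rpow_neg (by norm_num), Real.rpow_natCast, one_div, inv_pow]
    rw [e1]
    have hlog9 : 2 ≤ Real.log 9 := by
      rw [Real.le_log_iff_exp_le (by norm_num)]
      have := Real.exp_one_lt_d9
      have h2 : Real.exp 2 = Real.exp 1 * Real.exp 1 := by rw [← Real.exp_add]; norm_num
      nlinarith [Real.exp_pos 1]
    calc (9 : ℝ) ^ (-(n₀ : ℝ)) ≤ (9 : ℝ) ^ (β - s) :=
          Real.rpow_le_rpow_of_exponent_le (by norm_num) (by linarith)
      _ = (9 : ℝ) ^ β * (9 : ℝ) ^ (-s) := by rw [sub_eq_add_neg, Real.rpow_add (by norm_num)]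
      _ ≤ (9 : ℝ) ^ β * Real.exp (-(2 * s)) := by
          gcongr
          rw [Real.rpow_def_of_pos (by norm_num)]
          exact Real.exp_le_exp.mpr (by nlinarith)
  -- (d) powers of `s` against `e^{-s}`: `s^{M} e^{-s} ≤ M!`, and `(log y)^{-e} ≥ s^{-2}`, `s^{-κ} ≥ s^{-m'}`
  have hfac := pow_mul_exp_neg_le_factorial hs0.le M
  have hly : (s ^ 2)⁻¹ ≤ Real.log y ^ (-e) := by
    rw [← hss, ← pow_two, Real.rpow_neg (by positivity)]
    refine inv_anti₀ (Real.rpow_pos_of_pos (by positivity) _) ?_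
    calc (s ^ 2) ^ e ≤ (s ^ 2) ^ (1:ℝ) :=
          Real.rpow_le_rpow_of_exponent_le (by nlinarith) he1
      _ = s ^ 2 := Real.rpow_one _
  have hsk : (s ^ m')⁻¹ ≤ s ^ (-κ) := by
    rw [Real.rpow_neg hs0.le]
    refine inv_anti₀ (Real.rpow_pos_of_pos hs0 _) ?_
    rw [← Real.rpow_natCast s m']
    exact Real.rpow_le_rpow_of_exponent_le hs1 (Nat.le_ceil _)
  have hV9 : V ^ (-(9 : ℝ)) ≤ (K₁ * s ^ m') ^ 9 := by
    rw [Real.rpow_neg hVpos.le, show (9 : ℝ) = ((9 : ℕ) : ℝ) by norm_num, Real.rpow_natCast,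
      ← inv_pow]
    exact pow_le_pow_left₀ (inv_nonneg.mpr hVpos.le) hVinv 9
  have hVle : (K₁ * s ^ m')⁻¹ ≤ V := by rw [inv_le_comm₀ (by positivity) hVpos]; exact hVinv
  have hexp : Real.exp (-(2 * s)) = Real.exp (-s) * Real.exp (-s) := by
    rw [← Real.exp_add]; ring_nf
  -- (e) assembly
  calc discT par g β y (primesProdBelow z) N
      ≤ V ^ (-(9 : ℝ)) * ((1 / 9 : ℝ) ^ n₀ / (1 - 1 / 9)) := hsum
    _ ≤ (K₁ * s ^ m') ^ 9 * (((9 : ℝ) ^ β * Real.exp (-(2 * s))) / (1 - 1 / 9)) := by gcongr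
    _ = (9 / 8 * (9 : ℝ) ^ β * K₁ ^ 10 * (s ^ M * Real.exp (-s))) *
          ((K₁ * s ^ m')⁻¹ * ((s ^ m')⁻¹ * (Real.exp (-s) * (s ^ 2)⁻¹))) := by
        rw [hM, hexp]
        field_simp
        ring
    _ ≤ (9 / 8 * (9 : ℝ) ^ β * K₁ ^ 10 * M.factorial) *
          (V * (s ^ (-κ) * (Real.exp (-s) * Real.log y ^ (-e)))) := by
        gcongr
    _ = _ := by ring

/-- **Tail of the boundary series** (Rankin's trick with `Λ = 3`): for `N₁ ≤ N`,
`∑_{n ≤ N} T_n(y, P(z)) ≤ ∑_{n ≤ N₁} T_n(y, P(z)) + V(P(z))^{−3} 3^{−N₁} / 2` (each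
`T_n ≤ ∑_{ν(t) = n} g(t) ≤ 3^{−n} ∏ (1 + 3 g(p)) ≤ 3^{−n} V^{−3}`). [folklore] -/
theorem discT_le_discT_add_tail {κ β : ℝ} {g : ArithmeticFunction ℝ} (hg : g.IsMultiplicative)
    (hdim : HasIwaniecDimension g κ L) (y z : ℝ) (par : ℕ) {N₁ N : ℕ} (hN : N₁ ≤ N) :
    discT par g β y (primesProdBelow z) N ≤
      discT par g β y (primesProdBelow z) N₁ +
        vprod g (primesProdBelow z) ^ (-(3 : ℝ)) * (1 / 3 : ℝ) ^ N₁ / 2 := by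
  set V := vprod g (primesProdBelow z) with hV
  have hVpos : 0 < V := hdim.vprod_pos z
  have h01 : ∀ p ∈ (primesProdBelow z).primeFactors, 0 ≤ g p ∧ g p < 1 := fun p hp =>
    hdim.1 p (Nat.prime_of_mem_primeFactors hp)
  have h01' : ∀ p ∈ (primesProdBelow z).primeFactors, 0 ≤ g p ∧ g p ≤ 1 := fun p hp =>
    ⟨(h01 p hp).1, (h01 p hp).2.le⟩
  have hPsq := squarefree_primesProdBelow z
  have hterm : ∀ n, bdrySum par g β y (primesProdBelow z) n ≤ V ^ (-(3 : ℝ)) * (1 / 3 : ℝ) ^ n := by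
    intro n
    calc bdrySum par g β y (primesProdBelow z) n
        ≤ ∑ t ∈ (primesProdBelow z).divisors with t.primeFactors.card = n, g t :=
          bdrySum_le_sum hg hPsq h01' par β y n
      _ ≤ (∏ p ∈ (primesProdBelow z).primeFactors, (1 + 3 * g p)) / 3 ^ n :=
          sum_divisors_card_eq_le hg hPsq (fun p hp => (h01 p hp).1) (by norm_num) n
      _ ≤ V ^ (-(3 : ℝ)) / 3 ^ n :=
          div_le_div_of_nonneg_right (prod_one_add_mul_le h01 (by norm_num)) (by positivity)
      _ = V ^ (-(3 : ℝ)) * (1 / 3 : ℝ) ^ n := by rw [one_div, inv_pow, div_eq_mul_inv]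
  rw [discT, discT, ← Finset.sum_range_add_sum_Ico _ (Nat.succ_le_succ hN)]
  gcongr
  calc ∑ n ∈ Finset.Ico (N₁ + 1) (N + 1), bdrySum par g β y (primesProdBelow z) n
      ≤ ∑ n ∈ Finset.Ico (N₁ + 1) (N + 1), V ^ (-(3 : ℝ)) * (1 / 3 : ℝ) ^ n :=
        Finset.sum_le_sum fun n _ => hterm n
    _ = V ^ (-(3 : ℝ)) * ∑ n ∈ Finset.Ico (N₁ + 1) (N + 1), (1 / 3 : ℝ) ^ n := by rw [Finset.mul_sum]
    _ ≤ V ^ (-(3 : ℝ)) * ((1 / 3 : ℝ) ^ (N₁ + 1) / (1 - 1 / 3)) :=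
        mul_le_mul_of_nonneg_left (geom_sum_Ico_le_of_lt_one (by norm_num) (by norm_num))
          (Real.rpow_nonneg hVpos.le _)
    _ = V ^ (-(3 : ℝ)) * (1 / 3 : ℝ) ^ N₁ / 2 := by rw [pow_succ]; ring

end Crude

end BetaSieve

end Literature.NumberTheory.Sieve
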